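import Summits.QuantumFields.BalabanUV.T4Continuum.Support.ShellMeasureHistoriesTransport

/-!
# `T4Continuum.ShellMeasureHistoriesTransportIterate` — row S103a f2: THE TRANSPORT IDENTIFICATION ITERATED ALONG A TOWER
# OF AVERAGING STEPS (every step under its own absolute-continuity hypothesis) — so that for a slot of ANY age the
# identification `(histLaw …).map π = layer law` of S103a §2 is KERNEL, and only the reading `u s = u' ∘ π` is a dictionary sentence
(cell `pub-balaban`, sub-cell `t4`, spine estimate NE7c (node U5b); NE7c ROUND-2 crew, unit `b2b-balaban-t4-ne7c-formalise-leaf-08`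
gen 16; owner table row **S103a** (R-ne7cp1-g35-6 (a)); file 2, answering R-ne7cp1-g35-6 (b)'s «[O] if abstract; [K] if `π` is the
tree's DEFINED iterated block averaging — say which»: [K] at every age, GIVEN the per-step `HaarAC`-type hypotheses; imports S103a f1
`ShellMeasureHistoriesTransport` ONLY; [folklore] measure theory; 0 `def`, 0 `def … : Prop`, 0 sorry, 0 citation tags)

HONEST FRAMING.  Finite four-torus programme, rung (B)+1 only — NOT infinite volume, NOT a mass gap, NOT the Clay problem, NOT
summit progress; (B), `BetaPertHyp`, (B^μ) not consumed.  NE7c NOT PRINTED, NOT PROVED; «NE7c ⇐ the named binders» (c3).  Plumbing on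
OUR side: an induction over `Measure.map_map` and S103a §4; nothing of Bałaban's asserted or discharged; NOTHING in the countdown
moves.  HONEST DEPENDENCY (cell): continuum YM on T⁴ ⇐ BetaPertH ∧ nine spine estimates (0/9 proved); BetaPertH ⇐ (D1) ∧ (D4) ∧
CAP+tail; G-an2-4 gates asym, D1 and NE2/3/4.

CONTENT (def-free: the iterated maps `π m` and densities `ρ m` are FAMILIES supplied by the consumer together with their one-step
recursions — the tree's `Setup`∕`T4Spectator.IsRTChain` style).
* `map_withDensity_tower` — for a FINITE tower `β 0 → β 1 → … → β M` of standard Borel layers with finite references `ν m`,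
  steps `avg m` (measurable, `(ν m).map (avg m) ≪ ν (m+1)` for `m < M` — the levels of a finite torus scheme), iterated maps
  `π (m+1) = avg m ∘ π m` (`m < M`), `π 0 = id`, and densities `ρ (m+1) = kernelTransport (ν m) (ν (m+1)) (avg m) (ρ m)` (`m < M`)
  from a nonnegative integrable `ρ 0`: for every `m ≤ M`, `ρ m` is nonnegative and `ν m`-integrable and
  `((ν 0).withDensity (ofReal ∘ ρ 0)).map (π m) = (ν m).withDensity (ofReal ∘ ρ m)`.
* `slotAntiConcentration_of_tower` — hence (M1) on layer `m ≤ M` along `u'` pulls back to (M1) on the finest layer along `u' ∘ π m`,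
  SAME `θ ρ D`, with NO identification hypothesis left (S103a §2 `slotAntiConcentration_of_layer`).
NOT HERE: the instantiation `avg m :=` Bałaban's block averaging with the exp-mean-log small-loop average (`BlockAveraging.avgFun`;
its `HaarAC` is the tree's `haarAC_avgFun_expMeanLogSU_SUN` in the standing range) — one line per step for the S103b holder, who
fixes the tower typing (`Params`, levels); the slot READING `u s = u' ∘ π m` stays [dict] (B14 (2.16) TYPE, class O).
-/

noncomputable section

open MeasureTheory Set

namespace Summit.QuantumFields.BalabanUV.T4Continuum.ShellMeasureHistoriesTransportIterate

open scoped ENNReal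
open Literature.MathematicalPhysics.QuantumFieldTheory.Balaban1983to89
open T4ShellMeasure (SlotAntiConcentration)
open T4AveragingDisintegration (kernelTransport kernelTransport_nonneg integrable_kernelTransport)
open ShellMeasureHistoriesTransport (map_withDensity_eq_withDensity_kernelTransport slotAntiConcentration_of_layer)

variable {β : ℕ → Type*} [∀ m, MeasurableSpace (β m)] [∀ m, StandardBorelSpace (β m)] [∀ m, Nonempty (β m)]

/-- **THE TRANSPORT IDENTIFICATION ALONG A FINITE TOWER OF AVERAGING STEPS.**  Layers `β m` (standard Borel, nonempty), finite
references `ν m`, and for the `M` steps `m < M`: measurable `avg m : β m → β (m+1)` with `(ν m).map (avg m) ≪ ν (m+1)` (the cell's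
`HaarAC` TYPE, per step — a finite torus scheme has finitely many levels, so nothing is asked beyond `M`), iterated maps
`π m : β 0 → β m` with `π 0 = id`, `π (m+1) = avg m ∘ π m`, and densities `ρ m : β m → ℝ` with
`ρ (m+1) = kernelTransport (ν m) (ν (m+1)) (avg m) (ρ m)` from a nonnegative `ν 0`-integrable `ρ 0`.  Then for every `m ≤ M`: `ρ m` is
nonnegative, `ν m`-integrable, `π m` is measurable, and `((ν 0).withDensity (ofReal ∘ ρ 0)).map (π m) = (ν m).withDensity (ofReal ∘ ρ m)`
— the image of the tilted finest law on layer `m` IS the layer reference tilted by the `m`-fold kernel transport. [folklore] -/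
theorem map_withDensity_tower (ν : ∀ m, Measure (β m)) [∀ m, IsFiniteMeasure (ν m)] (avg : ∀ m, β m → β (m + 1))
    {M : ℕ} (havg : ∀ m < M, Measurable (avg m)) (hac : ∀ m < M, (ν m).map (avg m) ≪ ν (m + 1)) (π : ∀ m, β 0 → β m)
    (hπ0 : π 0 = id) (hπs : ∀ m < M, π (m + 1) = avg m ∘ π m) (ρ : ∀ m, β m → ℝ)
    (hρs : ∀ m < M, ρ (m + 1) = kernelTransport (ν m) (ν (m + 1)) (avg m) (ρ m)) (hρ0i : Integrable (ρ 0) (ν 0))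
    (hρ00 : ∀ x, 0 ≤ ρ 0 x) :
    ∀ m ≤ M, (∀ x, 0 ≤ ρ m x) ∧ Integrable (ρ m) (ν m) ∧ Measurable (π m) ∧
      ((ν 0).withDensity fun x => ENNReal.ofReal (ρ 0 x)).map (π m) = (ν m).withDensity fun x => ENNReal.ofReal (ρ m x) := by
  intro m hm
  induction m with
  | zero =>
    refine ⟨hρ00, hρ0i, by rw [hπ0]; exact measurable_id, ?_⟩
    rw [hπ0, Measure.map_id]
  | succ m ih =>
    have hm' : m < M := by omega
    obtain ⟨h0, hi, hπm, hmap⟩ := ih hm'.le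
    refine ⟨fun x => ?_, ?_, ?_, ?_⟩
    · rw [hρs m hm']; exact kernelTransport_nonneg h0 x
    · rw [hρs m hm']; exact integrable_kernelTransport (ν m) (ν (m + 1)) (havg m hm') (hac m hm') hi
    · rw [hπs m hm']; exact (havg m hm').comp hπm
    · rw [hπs m hm', ← Measure.map_map (havg m hm') hπm, hmap, hρs m hm']
      exact map_withDensity_eq_withDensity_kernelTransport (ν m) (ν (m + 1)) (havg m hm') (hac m hm') hi h0

/-- **(M1) PULLS BACK FROM ANY LAYER OF THE TOWER TO THE FINEST LAYER, NO IDENTIFICATION HYPOTHESIS LEFT.**  With the tower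
data of `map_withDensity_tower`: if the layer-`m` law `(ν m).withDensity (ofReal ∘ ρ m)` satisfies (M1) along `u'`, then the tilted
finest law `(ν 0).withDensity (ofReal ∘ ρ 0)` satisfies (M1) along `u' ∘ π m`, SAME `θ ρ' D`, for every layer `m ≤ M` of the
finite tower (S103a §2 `slotAntiConcentration_of_layer` with the identification supplied by the tower). [folklore] -/
theorem slotAntiConcentration_of_tower (ν : ∀ m, Measure (β m)) [∀ m, IsFiniteMeasure (ν m)] (avg : ∀ m, β m → β (m + 1))
    {M : ℕ} (havg : ∀ m < M, Measurable (avg m)) (hac : ∀ m < M, (ν m).map (avg m) ≪ ν (m + 1)) (π : ∀ m, β 0 → β m)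
    (hπ0 : π 0 = id) (hπs : ∀ m < M, π (m + 1) = avg m ∘ π m) (ρ : ∀ m, β m → ℝ)
    (hρs : ∀ m < M, ρ (m + 1) = kernelTransport (ν m) (ν (m + 1)) (avg m) (ρ m)) (hρ0i : Integrable (ρ 0) (ν 0))
    (hρ00 : ∀ x, 0 ≤ ρ 0 x) {m : ℕ} (hm : m ≤ M) {u' : β m → ℝ} {θ ρ' D : ℝ}
    (h : SlotAntiConcentration ((ν m).withDensity fun x => ENNReal.ofReal (ρ m x)) u' θ ρ' D) :
    SlotAntiConcentration ((ν 0).withDensity fun x => ENNReal.ofReal (ρ 0 x)) (u' ∘ π m) θ ρ' D := by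
  obtain ⟨-, -, hπm, hmap⟩ := map_withDensity_tower ν avg havg hac π hπ0 hπs ρ hρs hρ0i hρ00 m hm
  exact slotAntiConcentration_of_layer hπm rfl hmap h

/-- **THE HISTORIES-ROAD FORM**: for a history's law `histLaw ((ν 0).withDensity H) sm u ϑ` over the tilted finest reference
(`H` measurable with `H = ofReal ∘ h`, `h ≥ 0` — the history's sectioned density in real form), the product `h · smallProd` is the
tower's `ρ 0`; (M1) on a layer `m ≤ M` for `(ν m).withDensity (ofReal ∘ ρ m)` along `u'` and the reading `u s = u' ∘ π m` give (M1)
for the history's law along `u s` (S103a §1 `histLaw_withDensity` + `slotAntiConcentration_of_tower`). [folklore] -/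
theorem slotAntiConcentration_histLaw_of_tower {σ : Type*} (ν : ∀ m, Measure (β m)) [∀ m, IsFiniteMeasure (ν m)]
    (avg : ∀ m, β m → β (m + 1)) {M : ℕ} (havg : ∀ m < M, Measurable (avg m))
    (hac : ∀ m < M, (ν m).map (avg m) ≪ ν (m + 1))
    (π : ∀ m, β 0 → β m) (hπ0 : π 0 = id) (hπs : ∀ m < M, π (m + 1) = avg m ∘ π m)
    {h : β 0 → ℝ} (hh0 : ∀ x, 0 ≤ h x) (hhm : Measurable h) (sm : Finset σ) {u : σ → β 0 → ℝ}
    (hu : ∀ s, Measurable (u s)) (ϑ : σ → ℝ)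
    (ρ : ∀ m, β m → ℝ) (hρ0 : ρ 0 = fun x => h x * ShellMeasureRootCompositionHistories.smallProd sm u ϑ x)
    (hρs : ∀ m < M, ρ (m + 1) = kernelTransport (ν m) (ν (m + 1)) (avg m) (ρ m)) (hρ0i : Integrable (ρ 0) (ν 0))
    {m : ℕ} (hm : m ≤ M) {s : σ} {u' : β m → ℝ} (hread : u s = u' ∘ π m) {θ ρ' D : ℝ}
    (hlay : SlotAntiConcentration ((ν m).withDensity fun x => ENNReal.ofReal (ρ m x)) u' θ ρ' D) :
    SlotAntiConcentration
      (ShellMeasureRootCompositionHistories.histLaw ((ν 0).withDensity fun x => ENNReal.ofReal (h x)) sm u ϑ) (u s) θ ρ' D := by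
  have hρ00 : ∀ x, 0 ≤ ρ 0 x := fun x => by
    rw [hρ0]; exact mul_nonneg (hh0 x) (ShellMeasureRootCompositionHistories.smallProd_nonneg sm u ϑ x)
  have hlaw : ShellMeasureRootCompositionHistories.histLaw ((ν 0).withDensity fun x => ENNReal.ofReal (h x)) sm u ϑ =
      (ν 0).withDensity fun x => ENNReal.ofReal (ρ 0 x) := by
    rw [ShellMeasureHistoriesTransport.histLaw_withDensity (ν 0) (H := fun x => ENNReal.ofReal (h x))
      (ENNReal.measurable_ofReal.comp hhm) sm hu ϑ, hρ0]
    congr 1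
    funext x
    exact (ENNReal.ofReal_mul (hh0 x)).symm
  rw [hlaw, hread]
  exact slotAntiConcentration_of_tower ν avg havg hac π hπ0 hπs ρ hρs hρ0i hρ00 hm hlay

end Summit.QuantumFields.BalabanUV.T4Continuum.ShellMeasureHistoriesTransportIterate

end
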